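import Mathlib
import Summits.Ventures.PercRepro.TriangleCapRowTopLayers

/-!
# PercRepro — THE ROW BAND THEOREMS WITHOUT THE SIDE CONDITION `a + t < r`, AND THE FULL-BAND INTERVAL ON `n`
VERTICES (p3, gen 51; part 249)

In the band regime `4 t + 3 ≤ r` the side condition `a + t < r` of parts 239–240 (the star centre on the left) is
automatic for `a ≤ t`, and for `a ≥ t + 1` the truncated formula is the full band (`q = ⌊t / (a − 1)⌋ ≤ 1`): so
`cherry_row_band_exact_all` and `cherry_row_top_layers_all` hold for every row `a ≥ 3` with no side condition.
`vertex_band_full_interval`: on `n ≥ s + t + 1` vertices (`ℓ ≥ 2 t` non-neighbours) the band `t` of the pair-count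
spectrum is the whole interval `2 j ≤ t (t + 1)`.  Axioms: standard.
-/

namespace PercRepro

namespace TriangleCap

namespace C047

open Finset

/-- For `t + 1 ≤ a` the truncated band formula is the full band: `2 j ≤ t (t + 1)` implies
`2 j + 2 q t ≤ 2 t + t (t − 1) + (a − 1) q (q + 1)` with `q = ⌊t / (a − 1)⌋`. -/
theorem row_bound_of_full (a t j : ℕ) (ht : 1 ≤ t) (ha : t + 1 ≤ a) (hj : 2 * j ≤ t * (t + 1)) :
    2 * j + 2 * (t / (a - 1)) * t ≤ 2 * t + t * (t - 1) + (a - 1) * ((t / (a - 1)) * (t / (a - 1) + 1)) := by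
  have hq : t / (a - 1) ≤ 1 := Nat.div_le_of_le_mul (by omega)
  obtain ⟨t', rfl⟩ : ∃ t', t = t' + 1 := ⟨t - 1, by omega⟩
  rw [Nat.add_sub_cancel]
  have ha1 : t' + 1 ≤ a - 1 := by omega
  rcases Nat.le_one_iff_eq_zero_or_eq_one.mp hq with h | h <;> rw [h] <;> nlinarith [ha1]

/-- **THE BAND `t` OF THE ROW `a`, EVERY ROW `a ≥ 3`** (`1 ≤ t`, `4 t + 3 ≤ r`, `2 r ≥ 4 t + 6 + t (t + 1)`,
`2 a + r ≤ k` (`r + 7 ≤ k` at `a = 3`), `2 t (r − t − 1) + t (t + 1) < stabGapFull k a r`; `q = ⌊t / (a − 1)⌋`): the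
band is exactly `2 j + 2 q t ≤ 2 t + t (t − 1) + (a − 1) q (q + 1)` — the full band for `a ≥ t + 1`. -/
theorem cherry_row_band_exact_all (k a r t : ℕ) (ha3 : 3 ≤ a) (ht : 1 ≤ t) (hr4 : 4 * t + 3 ≤ r)
    (hr : 4 * t + 6 + t * (t + 1) ≤ 2 * r) (hk : 2 * a + r ≤ k) (hk3 : a = 3 → r + 7 ≤ k)
    (hlt : 2 * (t * (r - t - 1)) + t * (t + 1) < stabGapFull k a r) :
    (∀ (D : SimpleGraph (Fin k)) [DecidableRel D.Adj], K4mFree D → D.edgeFinset.card + r = a * (k - a) →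
        ∀ j, 2 * j ≤ t * (t + 1) →
        ∑ v, deg D v * deg D v + r * (k - 1 - r) + (2 * (t * (r - t - 1)) + 2 * j) = D.edgeFinset.card * k →
        2 * j + 2 * (t / (a - 1)) * t ≤ 2 * t + t * (t - 1) + (a - 1) * ((t / (a - 1)) * (t / (a - 1) + 1))) ∧
      (∀ j, 2 * j + 2 * (t / (a - 1)) * t ≤ 2 * t + t * (t - 1) + (a - 1) * ((t / (a - 1)) * (t / (a - 1) + 1)) →
        ∃ (D : SimpleGraph (Fin k)) (_ : DecidableRel D.Adj), K4mFree D ∧ D.edgeFinset.card + r = a * (k - a) ∧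
          ∑ v, deg D v * deg D v + r * (k - 1 - r) + (2 * (t * (r - t - 1)) + 2 * j) =
            D.edgeFinset.card * k) := by
  refine ⟨?_, ?_⟩
  · intro D _ hK hm j hj heq
    rcases Nat.lt_or_ge t a with hlt' | hge
    · exact row_bound_of_full a t j ht hlt' hj
    · exact cherry_row_band_bound k a r t ha3 ht hr4 hr (by omega) hk hk3 hlt j hj D hK hm heq (t / (a - 1))
  · intro j hj
    exact row_band_attained k a r t j (by omega) ht (by omega) (by omega) (by omega) hj

/-- **THE FIRST `T` LAYERS OF EVERY ROW `a ≥ 3`, EXACT, NO SIDE CONDITION** (`4 T + 3 ≤ r`,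
`2 r ≥ 4 T + 6 + T (T + 1)`, `2 a + r ≤ k`, `2 (T + 1)(r − T − 2) ≤ stabGapFull k a r`). -/
theorem cherry_row_top_layers_all (k a r T : ℕ) (ha3 : 3 ≤ a) (hr4 : 4 * T + 3 ≤ r)
    (hr : 4 * T + 6 + T * (T + 1) ≤ 2 * r) (hk : 2 * a + r ≤ k) (hk3 : a = 3 → r + 7 ≤ k)
    (hgap : 2 * ((T + 1) * (r - T - 2)) ≤ stabGapFull k a r) :
    (∀ (D : SimpleGraph (Fin k)) [DecidableRel D.Adj], K4mFree D → D.edgeFinset.card + r = a * (k - a) →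
        D.edgeFinset.card * k < ∑ v, deg D v * deg D v + r * (k - 1 - r) + 2 * ((T + 1) * (r - T - 2)) →
        ∃ t, t ≤ T ∧ ∃ j, 2 * j ≤ t * (t + 1) ∧
          2 * j + 2 * (t / (a - 1)) * t ≤ 2 * t + t * (t - 1) + (a - 1) * ((t / (a - 1)) * (t / (a - 1) + 1)) ∧
          ∑ v, deg D v * deg D v + r * (k - 1 - r) + (2 * (t * (r - t - 1)) + 2 * j) = D.edgeFinset.card * k) ∧
      (∀ t, t ≤ T → ∀ j, 2 * j ≤ t * (t + 1) →
        2 * j + 2 * (t / (a - 1)) * t ≤ 2 * t + t * (t - 1) + (a - 1) * ((t / (a - 1)) * (t / (a - 1) + 1)) →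
        ∃ (D : SimpleGraph (Fin k)) (_ : DecidableRel D.Adj), K4mFree D ∧ D.edgeFinset.card + r = a * (k - a) ∧
          ∑ v, deg D v * deg D v + r * (k - 1 - r) + (2 * (t * (r - t - 1)) + 2 * j) =
            D.edgeFinset.card * k) := by
  have hcard : Fintype.card (Fin k) = k := Fintype.card_fin k
  refine ⟨?_, ?_⟩
  · intro D _ hK hm hlt
    have hbip : ∃ A : Finset (Fin k), A.card = a ∧ BipSub D A := by
      by_contra hnb
      have h := (stab_table_rows_ge_three k a r ha3 hk (by omega) hk3).1 D hK hm hnb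
      omega
    obtain ⟨A, hA, hB⟩ := hbip
    have hH := bipSub_sum_deg_sq_add_disjEdgePairs D A hB a r hA (by rw [hcard]; exact hm) (by rw [hcard]; omega)
    rw [hcard] at hH
    have hr' : (missingGraph D A).edgeFinset.card = r :=
      card_edges_missingGraph D A hB a r hA (by rw [hcard]; exact hm)
    have hid := sum_deg_sq_add_disjEdgePairs (missingGraph D A)
    rw [hr'] at hid
    have hfree := cliqueFree_of_bipSub _ A (bipSub_missingGraph D A)
    rcases pair_count_spectrum_level (missingGraph D A) hfree T r hr4 hr' with ⟨t, ht, j, hj, h⟩ | h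
    · refine ⟨t, ht, j, hj, ?_, by omega⟩
      rcases Nat.eq_zero_or_pos t with rfl | hpos
      · have : j = 0 := by omega
        subst this
        simp
      · have hlt' : 2 * (t * (r - t - 1)) + t * (t + 1) < stabGapFull k a r := by
          have := band_lt_tail r T t (t * (t + 1) / 2) ht hr (by omega)
          have h2 : 2 * (t * (t + 1) / 2) = t * (t + 1) := by
            obtain ⟨c, hc⟩ := Nat.even_mul_succ_self t
            omega
          omega
        exact (cherry_row_band_exact_all k a r t ha3 hpos (by omega) (by nlinarith) hk hk3 hlt').1 D hK hm j hj
          (by omega)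
    · omega
  · intro t ht j hj hjq
    rcases Nat.eq_zero_or_pos t with rfl | hpos
    · have hj0 : j = 0 := by omega
      subst hj0
      have hK := k4mFree_bipMinusStar k a r
      have hE := card_edges_bipMinusStar k a r (by omega) (by omega)
      have hS := sum_deg_sq_bipMinusStar k a r (by omega) (by omega) (by omega)
      rw [hcard] at hS
      exact ⟨bipMinusStar k a r, inferInstance, hK, hE, by simpa using hS⟩
    · exact row_band_attained k a r t j (by omega) hpos (by omega) (by omega) (by omega) hjq

/-- **THE FULL-BAND INTERVAL ON `n` VERTICES** (`1 ≤ t`, `2 t ≤ s`, `s + t + 1 ≤ n`): every `2 j ≤ t (t + 1)` is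
attained by a triangle-free graph on `Fin n` with `s` edges and a vertex of degree `s − t`. -/
theorem vertex_band_full_interval (n s t j : ℕ) (ht : 1 ≤ t) (hs : 2 * t ≤ s) (hn : s + t + 1 ≤ n)
    (hj : 2 * j ≤ t * (t + 1)) :
    ∃ (H : SimpleGraph (Fin n)) (_ : DecidableRel H.Adj), H.CliqueFree 3 ∧ H.edgeFinset.card = s ∧
      (∃ w, deg H w + t = s) ∧ ∑ v, deg H v * deg H v + 2 * (t * (s - t - 1)) + 2 * j = s * (s + 1) := by
  obtain ⟨u, hu, m, hm, hjm⟩ := layer_band_full t j ht hj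
  have hn0 : 0 < n := by omega
  have ha : t + 1 ≤ t + 1 := le_rfl
  have hr : t + m ≤ s := by omega
  have han : t + 1 + s ≤ n := by omega
  refine ⟨missingGraph (layerWitness n (t + 1) s t u m hn0) (leftPart n (t + 1)), inferInstance,
    cliqueFree_of_bipSub _ _ (bipSub_missingGraph _ _),
    card_edges_missingGraph_layerWitness n (t + 1) s t u m hn0 ha hr han,
    ⟨fin' n hn0 0, by rw [deg_missingGraph_layerWitness_zero n (t + 1) s t u m hn0 ha hr han]; omega⟩, ?_⟩
  have hdec := sum_deg_sq_vertex_decomposition (missingGraph (layerWitness n (t + 1) s t u m hn0) (leftPart n (t + 1)))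
    (fin' n hn0 0)
  rw [deg_missingGraph_layerWitness_zero n (t + 1) s t u m hn0 ha hr han,
    offEdges_missingGraph_layerWitness n (t + 1) s t u m hn0 ha hr han, card_layerPairs n (t + 1) s t u m hn0 ha hr han,
    attach_layerWitness n (t + 1) s t u m hn0 hm ha hr han,
    offAdjPairs_layerWitness n (t + 1) s t u m hn0 ht hu ha hr han] at hdec
  rw [hdec]
  have hQP : u * (u - 1) ≤ t * (t - 1) := Nat.mul_le_mul hu (Nat.sub_le_sub_right hu 1)
  have h1 : t ≤ s := by omega
  have h2 : 1 ≤ s - t := by omega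
  rcases Nat.eq_zero_or_pos u with rfl | hupos
  · simp only [zero_mul, Nat.sub_zero] at hjm ⊢
    zify [h1, h2, hm, ht] at hjm ⊢
    linear_combination hjm
  · zify [h1, h2, hm, ht, hupos, hQP] at hjm ⊢
    linear_combination hjm

end C047

end TriangleCap

end PercRepro
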